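import Mathlib
import HarnessLib
import Summits.HubbardSuperconductivity.HubbardSuperconductivity.Theorems.KLProgrammeKLRegimeBetaSplitEdge
import Summits.HubbardSuperconductivity.HubbardSuperconductivity.Theorems.KLProgrammeKLRegimeSplitEdgeMassProfile
import Summits.HubbardSuperconductivity.HubbardSuperconductivity.Theorems.KLProgrammeKLRegimeSplitEngineV9

/-!
# Route `KLProgramme` — crux K3 gen 5, CHILD 1 at SLOT level for the (E2-v9) engine slot `EngineBoundsAtV9S`:
# `BetaSplitP Pr W` for EVERY bundle with split ⇐ `BetaSplitAtS2` and engine ⇒ `EngineBoundsAtV9S` — `betaSplitP_of_slotsV9S`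

Cell gate-hubbard-kl, seat hubbard-kl-k3c1-p1 (g4; interim child-1 pen per plan g12 02:13:06Z).  (E2-v9) (`…KLRegimeSplitEngineV9`, p1 g8; plan g12
(R12′)/(R13)) is (E2-v8) + the crossed particle–hole gains (X) `(P.Klam·U)²·(G.phGain n |k−k′|_𝕋 + G.phGain n |k+k′−Qm|_𝕋)`
in the `1 ≤ n` budget — the repair of this seat's E2-DRIVE finding (evidence #17–#19 on stmt-HubbardSuperconductivity-19855).  Child 1 closes on it
WITHOUT new mathematics: the chain of record (`betaSplitP_of_edgeClauses`, p474021, over `pairLadder_envelope_edge` p473596 and the cascade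
`sWaveCascade_envelope_edge` p473401) is already generic in an ENTRYWISE per-step extra family `𝔛 … j Qm k k′` with a per-scale size and a POINTWISE
scale sum; (X) has both — `≤ 2·CF·(Klam U)²` per scale and in scale sum, from `G.WF` (nonnegative profile, partial sums `≤ CF`).  So this file is
p475114's `betaSplitP_of_slotsV8S` (k3c1-p2) with `𝔛 j := thermalBar + legDressBarQ·countT + (Klam U)²·(max (phGain j |k−k′|_𝕋) 0 + max (phGain j
|k+k′−Qm|_𝕋) 0)` at `1 ≤ j` (the `max … 0` keeps the family nonnegative where `G.WF` is not in scope; under `G.WF` it is the raw term), numerals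
`(sG, sQ, tG, tQ, tN) = (3, 8, 10/3, 48, 15)` (leg line `12(tQ+sQ)+tQ = 720 ≤ klLegKappa` unchanged).  Helper arithmetic
`klbs9_*`.  The gen-5 closer `betaSplitP_klPredsV14 W := betaSplitP_of_slotsV9S (Pr := klPredsV14) id id` is one line once the bundle is filed.
Everything is proved; nothing about the model is asserted.  0 kit.
-/

noncomputable section

namespace Summit.HubbardSuperconductivity.HubbardSuperconductivity.Theorems.KLRegimeSplit

set_option linter.dupNamespace false -- summit = problem name (single-conjunct summit), D-0017

open Real Finset Literature.MathematicalPhysics.QuantumLattice Literature.Probability.LatticeModels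
open Summit.HubbardSuperconductivity.HubbardSuperconductivity.Theorems.KLProgrammeLegKernels
open Summit.HubbardSuperconductivity.HubbardSuperconductivity.Theorems.CooperChannelRiccatiFlow
open Summit.HubbardSuperconductivity.HubbardSuperconductivity.Theorems.DispersionFlow

/-- One crossed-channel gain is at most `G.CF` (from `G.WF`: nonnegative profile with partial sums `≤ CF`). -/
theorem klbs9_phGain_le_CF {G : GeoConsts} (hG : G.WF) (n : ℕ) {ρ : ℝ} (hρ : 0 ≤ ρ) : G.phGain n ρ ≤ G.CF := by
  have h0 : ∀ m, 0 ≤ G.phGain m ρ := fun m => hG.2.2.2.2.2.2.2.2.2.2.2.2.1 m ρ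
  have hs := hG.2.2.2.2.2.2.2.2.2.2.2.2.2.2.1 ρ (n + 1) hρ
  exact (single_le_sum (f := fun m => G.phGain m ρ) (fun m _ => h0 m) (mem_range.2 (Nat.lt_succ_self n))).trans hs

/-- The (manifestly nonnegative) crossed-channel extra term `(Klam U)²·(max (phGain n ρ₁) 0 + max (phGain n ρ₂) 0)` is `≥ 0` — no `G.WF` needed. -/
theorem klbs9_X_nonneg (G : GeoConsts) (P : SplitConsts) (U : ℝ) (n : ℕ) (ρ₁ ρ₂ : ℝ) :
    0 ≤ (P.Klam * U) ^ 2 * (max (G.phGain n ρ₁) 0 + max (G.phGain n ρ₂) 0) :=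
  mul_nonneg (sq_nonneg _) (add_nonneg (le_max_right _ _) (le_max_right _ _))

/-- The raw (E2-v9) term is below the nonnegative version: `(Klam U)²·(ph₁ + ph₂) ≤ (Klam U)²·(max ph₁ 0 + max ph₂ 0)`. -/
theorem klbs9_X_le_X (G : GeoConsts) (P : SplitConsts) (U : ℝ) (n : ℕ) (ρ₁ ρ₂ : ℝ) :
    (P.Klam * U) ^ 2 * (G.phGain n ρ₁ + G.phGain n ρ₂) ≤ (P.Klam * U) ^ 2 * (max (G.phGain n ρ₁) 0 + max (G.phGain n ρ₂) 0) :=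
  mul_le_mul_of_nonneg_left (add_le_add (le_max_left _ _) (le_max_left _ _)) (sq_nonneg _)

/-- Per scale, under `G.WF`: `(Klam U)²·(max ph₁ 0 + max ph₂ 0) ≤ 2·(CF·(Klam U)²)` for `ρ₁, ρ₂ ≥ 0`. -/
theorem klbs9_X_le {G : GeoConsts} (hG : G.WF) (P : SplitConsts) (U : ℝ) (n : ℕ) {ρ₁ ρ₂ : ℝ} (h₁ : 0 ≤ ρ₁) (h₂ : 0 ≤ ρ₂) :
    (P.Klam * U) ^ 2 * (max (G.phGain n ρ₁) 0 + max (G.phGain n ρ₂) 0) ≤ 2 * (G.CF * (P.Klam * U) ^ 2) := by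
  have h0 := hG.2.2.2.2.2.2.2.2.2.2.2.2.1
  rw [max_eq_left (h0 n ρ₁), max_eq_left (h0 n ρ₂)]
  have ha := klbs9_phGain_le_CF hG n h₁
  have hb := klbs9_phGain_le_CF hG n h₂
  nlinarith [sq_nonneg (P.Klam * U)]

/-- Scale sums, under `G.WF`: `Σ_{n ∈ range N} (Klam U)²·(max ph₁ 0 + max ph₂ 0) ≤ 2·(CF·(Klam U)²)` for `ρ₁, ρ₂ ≥ 0`. -/
theorem klbs9_X_sum_le {G : GeoConsts} (hG : G.WF) (P : SplitConsts) (U : ℝ) (N : ℕ) {ρ₁ ρ₂ : ℝ} (h₁ : 0 ≤ ρ₁) (h₂ : 0 ≤ ρ₂) :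
    ∑ n ∈ range N, (P.Klam * U) ^ 2 * (max (G.phGain n ρ₁) 0 + max (G.phGain n ρ₂) 0) ≤ 2 * (G.CF * (P.Klam * U) ^ 2) := by
  have h0 := hG.2.2.2.2.2.2.2.2.2.2.2.2.1
  have heq : ∀ n ∈ range N, (P.Klam * U) ^ 2 * (max (G.phGain n ρ₁) 0 + max (G.phGain n ρ₂) 0) =
      (P.Klam * U) ^ 2 * (G.phGain n ρ₁ + G.phGain n ρ₂) := fun n _ => by rw [max_eq_left (h0 n ρ₁), max_eq_left (h0 n ρ₂)]
  rw [sum_congr rfl heq]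
  have ha := hG.2.2.2.2.2.2.2.2.2.2.2.2.2.2.1 ρ₁ N h₁
  have hb := hG.2.2.2.2.2.2.2.2.2.2.2.2.2.2.1 ρ₂ N h₂
  rw [← mul_sum, sum_add_distrib]
  nlinarith [sq_nonneg (P.Klam * U)]

/-- **Child 1 at slot level for the V9S engine slot ((E2-v9) = V8 + crossed-channel gains (X)), every bundle and window.**  If
`BetaSplitAtS2 ⇒ Pr.split` and `Pr.engine ⇒ EngineBoundsAtV9S`, then `BetaSplitP Pr W`.  Proof = p475114's `betaSplitP_of_slotsV8S` with the extra
family enlarged by (X) (numerals `(sG, sQ, tG, tQ, tN) = (3, 8, 10/3, 48, 15)`; (X) is entrywise, `≤ 2·CF·(Klam U)²` per scale and in scale sum by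
`G.WF`). -/
theorem betaSplitP_of_slotsV9S {Pr : Preds} {W : Set ℝ}
    (hs : ∀ (L M : ℕ) [NeZero L] [NeZero M] (G : GeoConsts) (P : SplitConsts) (Q : EngConsts) (β U μ : ℝ) (K : TrigPolyC4v) (n : ℕ),
      BetaSplitAtS2 L M G P Q β U μ K n → Pr.split L M G P Q β U μ K n)
    (he : ∀ (L M : ℕ) [NeZero L] [NeZero M] (G : GeoConsts) (P : SplitConsts) (Q : EngConsts) (β U μ : ℝ) (K : TrigPolyC4v) (n : ℕ),
      Pr.engine L M G P Q β U μ K n → EngineBoundsAtV9S L M G P Q β U μ K n) :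
    BetaSplitP Pr W := by
  refine betaSplitP_of_edgeClauses (Pr := Pr) (sG := 3) (sQ := 8) (tG := 10 / 3) (tQ := 48) (tN := 15) (by norm_num) (by norm_num)
    (by norm_num) (by norm_num) (by norm_num) (by unfold klLegKappa; norm_num)
    (fun L G P Q β U μ K j Qm k k' =>
      if 1 ≤ j then thermalBar G P U β j + legDressBarQ G P Q U j (legSliceCountT L β μ K j ![k', Qm - k', Qm - k, k]) +
        (P.Klam * U) ^ 2 * (max (G.phGain j (klTorusNorm L (k - k'))) 0 + max (G.phGain j (klTorusNorm L (k + k' - Qm))) 0)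
      else legDressBarQ G P Q U 0 4)
    ?_ ?_ ?_ ?_ (fun L G P Q β U μ K j Qm => 2 * klEdge G j (klTorusNorm L Qm)) ?_ hs ?_
  · -- nonnegativity
    intro L G P Q β U μ K j Qm k k' hG hP hQ
    have hCF : 0 ≤ G.CF := hG.2.2.2.2.2.2.2.2.2.2.2.2.2.1
    have hK0 : 0 ≤ P.Klam := zero_le_one.trans hP.1
    split_ifs
    · exact add_nonneg (add_nonneg (thermalBar_nonneg hCF P U β j) (legDressBarQ_nonneg G hK0 hQ.2.1 U j _))
        (klbs9_X_nonneg G P U j _ _)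
    · exact legDressBarQ_nonneg G hK0 hQ.2.1 U 0 _
  · -- per-scale size (`≤ 3·CF(Klam U)² + 8·CR·Klam³·U²`)
    intro L G P Q β U μ K j Qm k k' hG hP hQ hU hU1
    have hCF : 0 ≤ G.CF := hG.2.2.2.2.2.2.2.2.2.2.2.2.2.1
    have hK0 : 0 ≤ P.Klam := zero_le_one.trans hP.1
    have hCR : 0 ≤ Q.CR := hQ.2.1
    have hcr3 := cr3_le hP.1 hCR hU1
    have hq30 : 0 ≤ Q.CR * P.Klam ^ 3 * U ^ 2 := by positivity
    have hg20 : 0 ≤ G.CF * (P.Klam * U) ^ 2 := by positivity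
    split_ifs with hj
    · have h1 := thermalBar_le hCF P U β j
      have h2 := legDressBarQ_le G hK0 hCR U j (legSliceCountT L β μ K j ![k', Qm - k', Qm - k, k])
      have h4 : (legSliceCountT L β μ K j ![k', Qm - k', Qm - k, k] : ℝ) ≤ 4 := by
        exact_mod_cast legSliceCountT_le_four L β μ K j _
      have h3 : Q.CR * ((P.Klam * U) ^ 2 + (P.Klam * |U|) ^ 3) * (legSliceCountT L β μ K j ![k', Qm - k', Qm - k, k] : ℝ) ≤
          2 * Q.CR * P.Klam ^ 3 * U ^ 2 * 4 := mul_le_mul hcr3 h4 (Nat.cast_nonneg _) (by positivity)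
      have h5 : (P.Klam * U) ^ 2 * (max (G.phGain j (klTorusNorm L (k - k'))) 0 + max (G.phGain j (klTorusNorm L (k + k' - Qm))) 0) ≤
          2 * (G.CF * (P.Klam * U) ^ 2) := klbs9_X_le hG P U j (torusSupNorm_nonneg _) (torusSupNorm_nonneg _)
      linarith
    · have h2 := legDressBarQ_le G hK0 hCR U 0 4
      have h3 : Q.CR * ((P.Klam * U) ^ 2 + (P.Klam * |U|) ^ 3) * ((4 : ℕ) : ℝ) ≤ 2 * Q.CR * P.Klam ^ 3 * U ^ 2 * 4 := by
        rw [Nat.cast_ofNat]; nlinarith [hcr3]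
      linarith
  · -- scale sums over `(t, n]`
    intro L G P Q β U μ K t n Qm k k' hG hP hQ hU hU1 hn
    have hCF : 0 ≤ G.CF := hG.2.2.2.2.2.2.2.2.2.2.2.2.2.1
    have hK0 : 0 ≤ P.Klam := zero_le_one.trans hP.1
    have hcr3 := cr3_le hP.1 hQ.2.1 hU1
    have hq30 : 0 ≤ Q.CR * P.Klam ^ 3 * U ^ 2 := by have := hQ.2.1; positivity
    have heq : ∀ j ∈ Ioc t n, (if 1 ≤ j then thermalBar G P U β j +
        legDressBarQ G P Q U j (legSliceCountT L β μ K j ![k', Qm - k', Qm - k, k]) +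
        (P.Klam * U) ^ 2 * (max (G.phGain j (klTorusNorm L (k - k'))) 0 + max (G.phGain j (klTorusNorm L (k + k' - Qm))) 0)
        else legDressBarQ G P Q U 0 4) =
        thermalBar G P U β j + legDressBarQ G P Q U j (legSliceCountT L β μ K j ![k', Qm - k', Qm - k, k]) +
        (P.Klam * U) ^ 2 * (max (G.phGain j (klTorusNorm L (k - k'))) 0 + max (G.phGain j (klTorusNorm L (k + k' - Qm))) 0) := by
      intro j hj
      simp only [mem_Ioc] at hj
      rw [if_pos (by omega)]
    rw [sum_congr rfl heq, sum_add_distrib, sum_add_distrib]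
    have hsub : ∀ (f : ℕ → ℝ), (∀ j, 0 ≤ f j) → ∑ j ∈ Ioc t n, f j ≤ ∑ j ∈ range (n + 1), f j := fun f hf =>
      sum_le_sum_of_subset_of_nonneg (fun j hj => by simp only [mem_Ioc] at hj; exact mem_range.2 (by omega)) fun j _ _ => hf j
    have h1 : ∑ j ∈ Ioc t n, thermalBar G P U β j ≤ 4 / 3 * (G.CF * (P.Klam * U) ^ 2) :=
      (hsub _ fun j => thermalBar_nonneg hCF P U β j).trans (thermalBar_sum_le hCF P U β hn)
    have h2 : ∑ j ∈ Ioc t n, legDressBarQ G P Q U j (legSliceCountT L β μ K j ![k', Qm - k', Qm - k, k]) ≤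
        20 * (2 * Q.CR * P.Klam ^ 3 * U ^ 2) :=
      ((hsub _ fun j => legDressBarQ_nonneg G hK0 hQ.2.1 U j _).trans
          (legDressBarQ_countT_sum_le L G hK0 hQ.2.1 U β μ K _ n)).trans (by nlinarith [hcr3])
    have h3 : ∑ j ∈ Ioc t n, (P.Klam * U) ^ 2 * (max (G.phGain j (klTorusNorm L (k - k'))) 0 + max (G.phGain j (klTorusNorm L (k + k' - Qm))) 0) ≤
        2 * (G.CF * (P.Klam * U) ^ 2) :=
      (hsub _ fun j => klbs9_X_nonneg G P U j _ _).trans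
        (klbs9_X_sum_le hG P U (n + 1) (torusSupNorm_nonneg _) (torusSupNorm_nonneg _))
    linarith
  · -- scale sums `m ≤ n`: the scale-0 term plus the shifted inductive sums
    intro L G P Q β U μ K n Qm k k' hG hP hQ hU hU1 hn
    have hCF : 0 ≤ G.CF := hG.2.2.2.2.2.2.2.2.2.2.2.2.2.1
    have hK0 : 0 ≤ P.Klam := zero_le_one.trans hP.1
    have hCR : 0 ≤ Q.CR := hQ.2.1
    have hcr3 := cr3_le hP.1 hCR hU1
    have hq30 : 0 ≤ Q.CR * P.Klam ^ 3 * U ^ 2 := by positivity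
    have heq : ∀ i ∈ range n, (if 1 ≤ i + 1 then thermalBar G P U β (i + 1) +
        legDressBarQ G P Q U (i + 1) (legSliceCountT L β μ K (i + 1) ![k', Qm - k', Qm - k, k]) +
        (P.Klam * U) ^ 2 * (max (G.phGain (i + 1) (klTorusNorm L (k - k'))) 0 + max (G.phGain (i + 1) (klTorusNorm L (k + k' - Qm))) 0)
        else legDressBarQ G P Q U 0 4) =
        thermalBar G P U β (i + 1) + legDressBarQ G P Q U (i + 1) (legSliceCountT L β μ K (i + 1) ![k', Qm - k', Qm - k, k]) +
        (P.Klam * U) ^ 2 * (max (G.phGain (i + 1) (klTorusNorm L (k - k'))) 0 + max (G.phGain (i + 1) (klTorusNorm L (k + k' - Qm))) 0) :=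
      fun i _ => by rw [if_pos (by omega)]
    rw [if_neg (by omega), sum_congr rfl heq, sum_add_distrib, sum_add_distrib]
    have h0 := legDressBarQ_le G hK0 hCR U 0 4
    have h0' : Q.CR * ((P.Klam * U) ^ 2 + (P.Klam * |U|) ^ 3) * ((4 : ℕ) : ℝ) ≤ 2 * Q.CR * P.Klam ^ 3 * U ^ 2 * 4 := by
      rw [Nat.cast_ofNat]; nlinarith [hcr3]
    have h1 : ∑ i ∈ range n, thermalBar G P U β (i + 1) ≤ 4 / 3 * (G.CF * (P.Klam * U) ^ 2) :=
      (sum_range_succ_shift_le (f := fun m => thermalBar G P U β m) (fun m => thermalBar_nonneg hCF P U β m) n).trans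
        (thermalBar_sum_le hCF P U β hn)
    have h2 : ∑ i ∈ range n, legDressBarQ G P Q U (i + 1) (legSliceCountT L β μ K (i + 1) ![k', Qm - k', Qm - k, k]) ≤
        20 * (2 * Q.CR * P.Klam ^ 3 * U ^ 2) :=
      ((sum_range_succ_shift_le (f := fun m => legDressBarQ G P Q U m (legSliceCountT L β μ K m ![k', Qm - k', Qm - k, k]))
          (fun m => legDressBarQ_nonneg G hK0 hQ.2.1 U m _) n).trans
          (legDressBarQ_countT_sum_le L G hK0 hQ.2.1 U β μ K _ n)).trans (by nlinarith [hcr3])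
    have h3 : ∑ i ∈ range n, (P.Klam * U) ^ 2 *
        (max (G.phGain (i + 1) (klTorusNorm L (k - k'))) 0 + max (G.phGain (i + 1) (klTorusNorm L (k + k' - Qm))) 0) ≤
        2 * (G.CF * (P.Klam * U) ^ 2) :=
      (sum_range_succ_shift_le
          (f := fun m => (P.Klam * U) ^ 2 * (max (G.phGain m (klTorusNorm L (k - k'))) 0 + max (G.phGain m (klTorusNorm L (k + k' - Qm))) 0))
          (fun m => klbs9_X_nonneg G P U m _ _) n).trans
        (klbs9_X_sum_le hG P U (n + 1) (torusSupNorm_nonneg _) (torusSupNorm_nonneg _))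
    linarith
  · -- the sign-defect allowance `2·klEdge` is in-class scale-summable (verbatim from p475114)
    intro L G P Q β U μ K t Qm hG hP hQ hU hU1 ht hQt
    have hbhi : 0 ≤ G.bhi := hG.2.2.1.trans hG.2.2.2.1
    have h1 : ∑ i ∈ range t, 2 * klEdge G (i + 1) (klTorusNorm L Qm) =
        2 * G.bhi * ∑ i ∈ range t, min 1 ((2 * (4 : ℝ) ^ 5) * klTorusNorm L Qm * (4 : ℝ) ^ (i + 1)) := by
      rw [mul_sum]
      refine sum_congr rfl fun i _ => ?_
      rw [klEdge_eq_pow, show 2 * klTorusNorm L Qm * (4 : ℝ) ^ (i + 1 + 5) = (2 * (4 : ℝ) ^ 5) * klTorusNorm L Qm * (4 : ℝ) ^ (i + 1) by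
        rw [pow_add]; ring]
      ring
    have h2 : ∑ i ∈ range t, min 1 ((2 * (4 : ℝ) ^ 5) * klTorusNorm L Qm * (4 : ℝ) ^ (i + 1)) ≤ 22 / 3 :=
      (sum_min_one_edge_le (s := 6) (torusSupNorm_nonneg _) (by norm_num) hQt).trans (by norm_num)
    rw [h1]
    refine (mul_le_mul_of_nonneg_left h2 (by positivity : (0 : ℝ) ≤ 2 * G.bhi)).trans ?_
    linarith
  · -- the engine slot yields `EngineBoundsAtV9S`: project the clauses child 1 reads ((E2-v9): (m), (neg), right inverse, bound)
    intro L M _ _ G P Q β U μ K n h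
    have h' : EngineBoundsAtV9S L M G P Q β U μ K n := he L M G P Q β U μ K n h
    refine ⟨fun hn0 Qm k hk k' hk' => ?_, fun hn1 Qm hQ => ?_, fun hn1 Qm k hk k' hk' => ?_, h'.2.2.2.2.2.2.1, h'.2.2.2.2.2.2.2⟩
    · rw [if_neg (by omega)]
      exact h'.2.2.1.1 hn0 Qm k hk k' hk'
    · obtain ⟨w, hwabs, hwneg, N, hN, hb⟩ := h'.2.2.1.2 hn1 Qm hQ
      refine ⟨w, hwabs, hwneg, N, hN, fun k hk k' hk' => (hb k hk k' hk').trans ?_⟩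
      rw [if_pos hn1]
      have hx := klbs9_X_le_X G P U n (klTorusNorm L (k - k')) (klTorusNorm L (k + k' - Qm))
      linarith
    · have hx := klbs9_X_nonneg G P U n (klTorusNorm L (k - k')) (klTorusNorm L (k + k' - Qm))
      refine (h'.2.2.2.1 hn1 Qm k hk k' hk').trans ?_
      rw [if_pos hn1]
      linarith

end Summit.HubbardSuperconductivity.HubbardSuperconductivity.Theorems.KLRegimeSplit

end
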